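import Summits.QuantumFields.BalabanUV.Beta.MixedJetTablesPlug
import Literature.MathematicalPhysics.QuantumFieldTheory.Balaban1983to89.B12Beta

/-!
# `BalabanUV.Beta.D1BFx.FirstStepLargeBlock` — road «BF-x» for binder row D1, leaf O1: THE ONE-SHOT COEFFICIENT IS THE FIRST STEP AT A LARGE
# BLOCK — `shotCoeff … n μ ν` := the (1.22)-moment of the `j = 0` member of the β-lead's wall family taken at block size `Lc := n`

HONEST FRAMING (cell contract, verbatim): «discharging `BetaPertH` makes Bałaban's UV stability UNCONDITIONAL — a real constructive-QFT
result; it is NOT the continuum limit and NOT the Clay problem.»  HONEST DEPENDENCY (verbatim): «continuum YM on T⁴ ⇐ BetaPertH ∧ nine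
spine estimates (0/9 proved); BetaPertH ⇐ (D1) ∧ (D4) ∧ CAP+tail; G-an2-4 gates asym, D1 and NE2/3/4.»  THIS MODULE DISCHARGES NOTHING.
It is ONE DEFINITION over objects already in the tree (the β-lead's wall family literal `MixedJetTablesPlug.JsBalAn1Ctr`, an4/an2's
`OneStepKernelFamily.TbalOf`, `B12Beta.secondMoment`) plus its unfolding lemmas; no `Prop` is minted, nothing is cited as a hypothesis,
every colour weight, every block-size exponent and the Wilson 4-jet table `T` stay PARAMETERS (RULING (R18-3); the (P6) weight pin and the
UNITS audit X-an4-37/39 are NOT touched: the exponents `e` below are the SOCKET for «the powers `Lc^{d+1}, Lc^{2(d+1)}, …` the colour weights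
silently contain» of the `BalabanStepJetsSucc` UNITS paragraph, instantiated by nobody here).  0 sorry.  NOT summit progress.

ABSOLUTE RULE (cell, verbatim): «No internally-minted statement may enter as a cited fact. Every hypothesis is either kernel-proved in this
package or a verbatim quotation of a PUBLISHED theorem with page reference. The manuscript(s) under audit are NOT citable for their own
disputed steps — they are the thing under adjudication; programme-internal (2001/route/tribunal) claims are never citable.»

WHY (skeleton `HOME/beta/skeletons/D1-b2b-balaban-beta-d1-p2.md` v1.2/v1.3, node O, leaf O1).  The ONE-SHOT system with blocking factor `n`
— fine lattice `ℤ⁴`, ONE covariant averaging to the coarse lattice `n•ℤ⁴`, Wilson action, weak-Landau slice with axial dressing — IS the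
`j = 0` member of the wall family `TbalOf Lc (JsBalAn1Ctr …)` taken at `Lc := n` (`KInvStep n 0 = dec (n^0) (KInv (n^1))`; `BalabanStepJets.S0 3 n`
= Wilson cubic + one-step averaging border + Lagrange stencil at blocking `n`; an1's centred second-order tables and an3's `T` likewise).  Road
«BF-x» reads D1 as the LARGE-BLOCK ASYMPTOTICS OF THIS FIRST STEP: its target T (the cell's `D1Rep` shape) is
`∃ U, ∀ m ≥ 1, |shotCoeff … (Lc^m) μ ν − oneShotSide SL μ ν N a k (Lc^m)| ≤ U`, its mean form `shotCoeff … (Lc^m) μ ν / m → stepBal N Lc`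
(⟺ `β⁰_0(n)/log n → 11N²/(12π²)` along `n = Lc^m`), consumed by `D1BFx.RoadEnd.d1Drift_of_strongRoad` / `d1Drift_of_meanRoad(_table)` with
`c := shotCoeff …`.  [B12 p.264 (1.22): `β_{j+1}(g_j) = Σ_x Π_{j+1,μν}(g_j,x) x_μ x_ν`, `μ ≠ ν` — CONTEXT for which moment this is; nothing printed
is asserted.]

CONTENT (all [folklore]).
* `shotCoeff cE cVH cΛ cE₂ cB e T n μ ν` — for `1 ≤ n`: `secondMoment (TbalOf n (JsBalAn1Ctr (Lc := n) _ (cE·n^{e 0}) (cVH·n^{e 1}) (cΛ·n^{e 2})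
  (cE₂·n^{e 3}) (cB·n^{e 4}) T) 0) μ ν`; `0` for `n = 0`.  `e : Fin 5 → ℕ` = the block-size exponents of the five colour weights (socket).
* `shotCoeff_of_pos` (unfolding at `1 ≤ n`), `shotCoeff_zero`, `shotCoeff_self` (the `m = 1` anchor); the closed `Π`-form
  `hessKer (axDressK n (KInvStep n 0)) (axVertexOfK (KInvStep n 0) n S₀) W₀` is the β-lead's `TbalOf_JsBalAn1Ctr` at `j = 0`, by `rw`.
-/

open Literature.MathematicalPhysics.QuantumFieldTheory.Balaban1983to89
open Literature.MathematicalPhysics.QuantumFieldTheory.Balaban1983to89.Beta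
open ExpKernelCalculus (hessKer)
open OneStepKernelFamily (KInvStep TbalOf)
open AxialDressing (axDressK axVertexOfK)
open BalabanStepJetsSucc (JsBal0Of)
open Summit.QuantumFields.BalabanUV.Beta.MixedJetTablesPlug (JsBalAn1Ctr TbalOf_JsBalAn1Ctr)

namespace Summit.QuantumFields.BalabanUV.Beta.D1BFx.FirstStepLargeBlock

noncomputable section

/-- [folklore] `NeZero n` from `1 ≤ n`. -/
theorem neZero_of_one_le {n : ℕ} (h : 1 ≤ n) : NeZero n := ⟨Nat.one_le_iff_ne_zero.mp h⟩

/-- [folklore] **THE ONE-SHOT COEFFICIENT = THE FIRST STEP AT BLOCK SIZE `n`**: the (1.22)-moment, channel `(μ, ν)`, of the `j = 0` member of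
the β-lead's wall family `TbalOf n (JsBalAn1Ctr (Lc := n) …)` with the colour weights scaled by the block-size powers `n^{e i}` (socket `e`; the
(P6)/UNITS pin instantiates it) — the route-(α) DRESSED one-shot kernel with blocking factor `n`.  `0` at `n = 0`.  A DEFINITION; asserts
nothing. -/
def shotCoeff (cE cVH cΛ cE₂ cB : ℝ) (e : Fin 5 → ℕ) (T : Fin 4 → Fin 4 → Fin 4 → Fin 4 → ℝ) (n : ℕ) (μ ν : Fin 4) : ℝ :=
  if h : 1 ≤ n then
    haveI : NeZero n := neZero_of_one_le h
    B12Beta.secondMoment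
      (TbalOf n (JsBalAn1Ctr (Lc := n) h (cE * (n : ℝ) ^ e 0) (cVH * (n : ℝ) ^ e 1) (cΛ * (n : ℝ) ^ e 2) (cE₂ * (n : ℝ) ^ e 3)
        (cB * (n : ℝ) ^ e 4) T) 0) μ ν
  else 0

variable (cE cVH cΛ cE₂ cB : ℝ) (e : Fin 5 → ℕ) (T : Fin 4 → Fin 4 → Fin 4 → Fin 4 → ℝ)

/-- [folklore] At `n = 0` the coefficient is `0` by convention. -/
theorem shotCoeff_zero (μ ν : Fin 4) : shotCoeff cE cVH cΛ cE₂ cB e T 0 μ ν = 0 := by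
  simp [shotCoeff]

/-- [folklore] Unfolding at a positive block size (with the `NeZero` instance the caller holds). -/
theorem shotCoeff_of_pos {n : ℕ} [NeZero n] (h : 1 ≤ n) (μ ν : Fin 4) :
    shotCoeff cE cVH cΛ cE₂ cB e T n μ ν =
      B12Beta.secondMoment
        (TbalOf n (JsBalAn1Ctr (Lc := n) h (cE * (n : ℝ) ^ e 0) (cVH * (n : ℝ) ^ e 1) (cΛ * (n : ℝ) ^ e 2) (cE₂ * (n : ℝ) ^ e 3)
          (cB * (n : ℝ) ^ e 4) T) 0) μ ν := by
  unfold shotCoeff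
  rw [dif_pos h]

/-- [folklore] The one-shot coefficient at the step block itself (`n := Lc`, exponents read at `Lc`) IS `β⁰_0` of the wall family with those
weights — the `m = 1` anchor of CHECK N0 of the skeleton (here a tautology; the content of N0 is the (P6)/UNITS instantiation of `e`). -/
theorem shotCoeff_self {Lc : ℕ} [NeZero Lc] (hLc : 1 ≤ Lc) (μ ν : Fin 4) :
    shotCoeff cE cVH cΛ cE₂ cB e T Lc μ ν =
      B12Beta.secondMoment
        (TbalOf Lc (JsBalAn1Ctr hLc (cE * (Lc : ℝ) ^ e 0) (cVH * (Lc : ℝ) ^ e 1) (cΛ * (Lc : ℝ) ^ e 2) (cE₂ * (Lc : ℝ) ^ e 3)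
          (cB * (Lc : ℝ) ^ e 4) T) 0) μ ν :=
  shotCoeff_of_pos cE cVH cΛ cE₂ cB e T hLc μ ν

end

end Summit.QuantumFields.BalabanUV.Beta.D1BFx.FirstStepLargeBlock
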